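/-
Copyright (c) 2026. All rights reserved.
Released under Apache 2.0 license as described in the file LICENSE.
-/
import Literature.NumberTheory.ComplexMultiplication.DegenerateCMTypesCyclicPrimeSquare
import HarnessLib

/-!
# The CM types of a cyclic group of order `2p^k` and their ranks, for every `k`: the levels of equidistribution
# (Dodson's `⟨ρ⟩ × ℤ₉` is `k = 2`; `⟨ρ⟩ × ℤ₂₇`: primitive ranks `28, 26, 22, 20`)

B. Dodson, *On the Mumford–Tate group of an abelian variety with complex multiplication*, J. Algebra **111**
(1987) 49–73 [Dodson1987] (held text `paper:doi-10-1016-0021-8693-87-90242-0`, pp. 69–71), §4.1, treats the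
cyclic "minimal group" `⟨ρ⟩ × ℤ₉` of degree `9` (Prop. 4.4 (1): "the orbits of order `9` give types with rank(`f`)
`= 8` or `10`"; Remark 4.5: "the existence of simple Abelian varieties of dimension `n = 18, 27, 36, 54`, and `72`
with rank `10`").  The companion file `DegenerateCMTypesCyclicPrimeSquare` proves Prop. 4.4 (1) for `⟨ρ⟩ × ℤ_{p²}`
and every odd prime `p`.  THIS FILE does the cyclic group `⟨ρ⟩ × ℤ_{p^k}` for EVERY `k ≥ 1` — the Galois group of
every cyclic CM field of degree `2p^k`, e.g. `ℚ(ζ₈₁)` (`54 = 2·27`), `ℚ(ζ₂₄₃)`, `ℚ(ζ₁₆₃)`, `ℚ(ζ₄₈₇)` — by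
T. Kubota's Lemma 2 [Kubota1965] (`rank = p^k + 1 − #{odd χ : χ(S) = 0}`, tree
`IsCMTypeWith.typeRank_add_ncard_oddCharacters_vanishing`) and the method of F. Hazama, *Hodge cycles on abelian
varieties with complex multiplication by cyclic CM-fields*, J. Math. Sci. Univ. Tokyo **10** (2003) [Hazama2003CyclicCM]
(Prop. 4.1: character sums in coordinates; Prop. 4.3: "the equations (4.4) are equivalent to the condition (4.5)
that `#{a ∈ R_i ; e_a = 1}` does not depend on `i`"; Lemma 4.6.1: stability), whose vocabulary (`pairSum`,
`signMatrix`, `rowCount`, `IsStableUnder` of `DegenerateCMTypesCyclicTwoOddPrimes`) is used VERBATIM in the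
DIGITS `b = p^{i+1} x + c` of `ℤ/p^k` (frame `τ = σ^{p^{i+1}}`, `κ = σ`, sizes `p^{k−i−1} × p^{i+1}`).

THE MECHANISM.  An odd character `χ` of `⟨ρ⟩ × ⟨σ⟩` is determined by `ω = χ(σ) ∈ μ_{p^k}`; if `ω` has order EXACTLY
`p^{i+1}` (`i < k`; there are `φ(p^{i+1}) = p^{i+1} − p^i` such `χ`), then
`χ(S) = Σ_{c ∈ ℤ/p^{i+1}} (2N(c) − p^{k−i−1}) ω^c` with `N(c) = #(S ∩ σᶜ⟨σ^{p^{i+1}}⟩)`, and the only rational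
relation among the `p^{i+1}`-th roots of unity in this range is `Φ_{p^{i+1}}(X) = Φ_p(X^{p^i})`: `χ(S) = 0` iff
`N(c + p^i) = N(c)` for all `c` — `S` is EQUIDISTRIBUTED among the `p` cosets of `⟨σ^{p^{i+1}}⟩` inside each coset
of `⟨σ^{p^i}⟩` ("LEVEL `i + 1`").  Level `k` is `σ^{p^{k−1}}S = S` (imprimitivity); level `1` is Hazama's "constant
row sums" on the cosets of `⟨σ^p⟩`.  Hence `rank(S) = p^k + 1 − Σ_{i<k} φ(p^{i+1})·[S equidistributed at level i+1]`.

## What is PROVED (theorems only; no definition, no named fact, no `sorry`)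

* §1 **`pairSum_pow_left_eq_zero_iff`** — the rational relations among the `p·p^m`-th roots of unity in the digits
  `(x, y) ∈ ℤ/p × ℤ/p^m`: `Σ ε(x,y) ω^{p^m x + y} = 0 ⟺ ε(x,y)` does not depend on `x` (Galois averaging over
  `a ≡ 1 (mod p)`, then `Φ_p`); **`sum_mul_pow_eq_zero_iff_periodic`** — one-variable form: `Σ_{c ∈ ℤ/n} f(c) ω^c = 0`
  (`ω` of order `n = p·p^m`) iff `f(c + p^m) = f(c)`.
* §2 the digits of `G` for `σ` of order `AB`: **`coord_bijective`**, `exists_coord`, **`sum_char_eq_pairSum`**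
  (`χ(S) = V(E(S); χ(σ)^B, χ(σ))`), `pairSum_one_left_eq`.
* §3 THE LEVELS: `sum_char_ne_zero_of_apply_eq_one` (`χ(σ) = 1`: never vanishes, `p^k` odd),
  **`sum_char_eq_zero_iff_level`** (`χ(σ)` of order exactly `p^{i+1}`: `χ(S) = 0` iff
  `rowCount (p^{k−i−1}) (p^{i+1}) S (σ^{p^{i+1}}) σ (c + p^i) = rowCount … c` for all `c ∈ ℤ/p^{i+1}`).
* §4 THE DEFECT: `sum_char_eq_zero_iff` (all odd `χ` at once), **`ncard_oddChar_vanishing_eq`**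
  (`= Σ_{i<k} φ(p^{i+1})·[level i+1]`).
* §5 THE RANKS: **`typeRank_add_defect_eq`** (`rank + Σ_{i<k} φ(p^{i+1})[level i+1] = p^k + 1`),
  **`typeRank_eq_iff`** (nondegenerate iff equidistributed at no level).
* §6 STABILISERS (`k ≥ 1`): **`exists_isStableUnder_iff`** (some `u ≠ 1` stabilises `S` iff `σ^{p^{k−1}}` does:
  the subgroup of order `p` is the least non-trivial subgroup of `⟨σ⟩`, and `ρ⟨σ⟩` never stabilises),
  `forall_not_isStableUnder_iff`, **`level_top_iff_isStableUnder`** (level `k` ⟺ `σ^{p^{k−1}}S = S`).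
* §7 **`typeRank_add_eq_of_primitive`** (primitive: the top level drops out), **`le_typeRank_of_primitive`**
  (primitive ⟹ `rank ≥ p^k − p^{k−1} + 2 = φ(p^k) + 2`), `typeRank_le_of_not_primitive` (imprimitive ⟹
  `rank ≤ p^{k−1} + 1`), **`primitive_iff_lt_typeRank`** (primitive ⟺ `rank > p^{k−1} + 1`).
* §8 `p^k = 27` (`σ` of order `27`, `|G| = 54`: the cyclic CM fields of degree `54`, `ℚ(ζ₈₁)`, `ℚ(ζ₁₆₃)`):
  **`typeRank_mem_of_primitive_twentySeven`** (primitive ⟹ rank `∈ {28, 26, 22, 20}`),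
  `typeRank_mem_of_not_primitive_twentySeven` (`∈ {10, 8, 4, 2}`), `primitive_iff_twentySeven` (primitive ⟺ rank `> 10`).

NOT here: the counts of the types at each level, the number-field dress (cyclic CM fields of degree `2p^k`,
`ℚ(ζ_{3^{m+1}})`), existence of types realising each combination of levels.

## References

* [Dodson1987] B. Dodson, J. Algebra 111 (1987) 49–73: §4.1 Prop. 4.1, Prop. 4.4 (1), Remark 4.5; §1 Thm. 1.12.
* [Hazama2003CyclicCM] F. Hazama, J. Math. Sci. Univ. Tokyo 10 (2003) 581–598: Prop. 2.3, Prop. 4.1 and (4.1),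
  Prop. 4.2, Prop. 4.3 ((4.4)–(4.5)), Lemma 4.6.1 ((4.7)), Thm. 4.8.
* [Kubota1965] T. Kubota, Trans. AMS 118 (1965), §4 Lemma 2.
* [Gordon1999HodgeAVSurvey] B. B. Gordon, *A survey of the Hodge conjecture for abelian varieties*, 9.4.1, 9.4.3.

## Provenance

Lane `lit-hodgefound` (Track 2, Layer A3 — CM types), seat `lit-hodgefound-p10` generation 35, row g35-#9;
neighbours cited by name, nothing restated: `DegenerateCMTypesCyclicTwoOddPrimes` (`pairSum`, `signMatrix`,
`rowCount`, `IsStableUnder`, `sum_mul_pow_eq_zero_iff_forall_eq`, `sum_signMatrix_row`),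
`DegenerateCMTypesCompositeDimension` (`Dodson1984.ncard_oddChar`), `CMTypeRankCharacters` (Kubota's Lemma 2),
`DegenerateCMTypesCyclicPrimeSquare` (the case `k = 2`).
-/

set_option autoImplicit false

noncomputable section

open scoped BigOperators
open Polynomial

namespace Literature.NumberTheory.ComplexMultiplication

namespace CyclicCMType

namespace PrimePow

/-! ## §1 Rational relations among the `p^{m+1}`-th roots of unity in the digits `b = p^m u + y` -/

section Roots

variable {p : ℕ} [hp : Fact p.Prime]

/-- Reindex a sum over `ZMod n` by the representatives `0, …, n − 1`. [folklore] -/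
private theorem sum_zmod_eq_sum_range {M : Type*} [AddCommMonoid M] {n : ℕ} [NeZero n] (f : ℕ → M) :
    ∑ k : ZMod n, f k.val = ∑ k ∈ Finset.range n, f k := by
  refine Finset.sum_nbij' (fun k => k.val) (fun k => (k : ZMod n)) ?_ ?_ ?_ ?_ ?_
  · intro k _; exact Finset.mem_range.2 (ZMod.val_lt k)
  · intro k _; exact Finset.mem_univ _
  · intro k _; exact ZMod.natCast_zmod_val k
  · intro k hk; exact ZMod.val_cast_of_lt (Finset.mem_range.1 hk)
  · intro k _; rfl

/-- `Σ_{x ∈ ℤ/p} νˣ = 0` for a primitive `p`-th root of unity `ν`. [folklore] -/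
private theorem sum_pow_val_eq_zero {ν : ℂ} (hν : IsPrimitiveRoot ν p) :
    ∑ x : ZMod p, ν ^ x.val = 0 := by
  haveI : NeZero p := ⟨hp.out.ne_zero⟩
  rw [sum_zmod_eq_sum_range (fun k => ν ^ k)]
  exact hν.geom_sum_eq_zero hp.out.one_lt

variable {q : ℕ} [hq : NeZero q]

/-- **Galois conjugates of a relation** `Σ_{x,y} ε(x,y) ω^{qx+y} = 0` (`ω` of order `pq`): the same relation
holds at `ωᵃ` for every `a` prime to `pq`. [folklore] -/
private theorem pairSum_pow_eq_zero_of_coprime {ω : ℂ} (hω : IsPrimitiveRoot ω (p * q))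
    (ε : ZMod p × ZMod q → ℤ) (h0 : pairSum ε (ω ^ q) ω = 0) {a : ℕ} (ha : a.Coprime (p * q)) :
    pairSum ε ((ω ^ a) ^ q) (ω ^ a) = 0 := by
  haveI : NeZero p := ⟨hp.out.ne_zero⟩
  have hn : 0 < p * q := Nat.mul_pos hp.out.pos (Nat.pos_of_ne_zero (NeZero.ne q))
  set P : ℚ[X] := ∑ xy : ZMod p × ZMod q, C (ε xy : ℚ) * X ^ (q * xy.1.val + xy.2.val) with hP
  have hPz : ∀ z : ℂ, aeval z P = pairSum ε (z ^ q) z := by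
    intro z
    simp only [hP, map_sum, map_mul, aeval_C, map_pow, aeval_X, eq_ratCast, Rat.cast_intCast]
    unfold pairSum
    refine Finset.sum_congr rfl fun xy _ => ?_
    rw [← pow_mul, ← pow_add]
  have hdvd : minpoly ℚ ω ∣ P := minpoly.dvd ℚ ω (by rw [hPz]; exact h0)
  have hωa : IsPrimitiveRoot (ω ^ a) (p * q) := hω.pow_of_coprime a ha
  have hroot : aeval (ω ^ a) (minpoly ℚ ω) = 0 := by
    rw [← cyclotomic_eq_minpoly_rat hω hn, aeval_def, ← eval_map, map_cyclotomic, ← IsRoot.def,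
      isRoot_cyclotomic_iff]
    exact hωa
  have := aeval_eq_zero_of_dvd_aeval_eq_zero hdvd hroot
  rwa [hPz] at this

/-- **Averaging the conjugates** `a = 1 + ps`, `s < q`, against `(ω^p)^{−sy₀}` (`q` a power of `p`, so that every
such `a` is prime to `pq`): a relation `Σ_{x,y} ε(x,y) ω^{qx+y} = 0` forces `Σ_x ε(x, y₀) (ω^q)ˣ = 0` for every
`y₀ ∈ ℤ/q` (Hazama's device (4.9)–(4.10)). [folklore] -/
private theorem sum_row_mul_pow_eq_zero {m : ℕ} (hqm : q = p ^ m) {ω : ℂ} (hω : IsPrimitiveRoot ω (p * q))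
    (ε : ZMod p × ZMod q → ℤ) (h0 : pairSum ε (ω ^ q) ω = 0) (y₀ : ZMod q) :
    ∑ x : ZMod p, (ε (x, y₀) : ℂ) * (ω ^ q) ^ x.val = 0 := by
  haveI : NeZero p := ⟨hp.out.ne_zero⟩
  have hp0 : 0 < p := hp.out.pos
  have hq0 : 0 < q := Nat.pos_of_ne_zero (NeZero.ne q)
  have hn : 0 < p * q := Nat.mul_pos hp0 hq0
  have hν : IsPrimitiveRoot (ω ^ q) p := hω.pow hn (mul_comm p q)
  have hθ : IsPrimitiveRoot (ω ^ p) q := hω.pow hn rfl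
  have hωn : ω ^ (p * q) = 1 := hω.pow_eq_one
  have hθq : (ω ^ p) ^ q = 1 := hθ.pow_eq_one
  have hω0 : ω ≠ 0 := hω.ne_zero hn.ne'
  -- the conjugate relations, simplified: `Σ_{x,y} ε(x,y) νˣ ωʸ θ^{sy} = 0` (`ν = ω^q`, `θ = ω^p`)
  have hconj : ∀ s : ℕ, ∑ xy : ZMod p × ZMod q,
      (ε xy : ℂ) * ((ω ^ q) ^ xy.1.val * (ω ^ xy.2.val * (ω ^ p) ^ (s * xy.2.val))) = 0 := by
    intro s
    have hap : (1 + p * s).Coprime p := (Nat.coprime_add_mul_left_left 1 p s).2 (Nat.coprime_one_left p)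
    have ha : (1 + p * s).Coprime (p * q) := by
      rw [hqm, ← pow_succ']
      exact Nat.Coprime.pow_right _ hap
    have h1 := pairSum_pow_eq_zero_of_coprime hω ε h0 ha
    have e1 : (ω ^ (1 + p * s)) ^ q = ω ^ q := by
      rw [← pow_mul, show (1 + p * s) * q = q + p * q * s by ring, pow_add, pow_mul, hωn, one_pow, mul_one]
    have e2 : ∀ y : ℕ, (ω ^ (1 + p * s)) ^ y = ω ^ y * (ω ^ p) ^ (s * y) := by
      intro y
      rw [← pow_mul, show (1 + p * s) * y = y + p * (s * y) by ring, pow_add, pow_mul]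
    unfold pairSum at h1
    rw [e1] at h1
    simpa only [e2] using h1
  -- the geometric sums `Σ_{s<q} (θ^{y + (q − y₀)})ˢ`: `q` for `y = y₀`, `0` otherwise
  have hgeom_self : ∑ s ∈ Finset.range q, ((ω ^ p) ^ (y₀.val + (q - y₀.val))) ^ s = (q : ℂ) := by
    rw [Nat.add_sub_cancel' (ZMod.val_lt y₀).le, hθq]
    simp
  have hgeom_ne : ∀ y : ZMod q, y ≠ y₀ →
      ∑ s ∈ Finset.range q, ((ω ^ p) ^ (y.val + (q - y₀.val))) ^ s = 0 := by
    intro y hy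
    have hθp : ((ω ^ p) ^ (y.val + (q - y₀.val))) ^ q = 1 := by
      rw [← pow_mul, mul_comm, pow_mul, hθq, one_pow]
    have hθ1 : (ω ^ p) ^ (y.val + (q - y₀.val)) ≠ 1 := by
      rw [Ne, hθ.pow_eq_one_iff_dvd]
      intro hd
      apply hy
      have hy' := ZMod.val_lt y
      have hy₀ := ZMod.val_lt y₀
      obtain ⟨c, hc⟩ := hd
      have hc1 : c = 1 := by
        rcases Nat.lt_or_ge c 2 with hc2 | hc2
        · interval_cases c
          · omega
          · rfl
        · have : q * 2 ≤ q * c := Nat.mul_le_mul_left q hc2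
          omega
      subst hc1
      apply ZMod.val_injective q
      omega
    rw [geom_sum_eq hθ1, hθp, sub_self, zero_div]
  -- weight the `s`-th relation by `θ^{s (q − y₀)}`, sum over `s < q`, and exchange the sums
  have hsum : ∑ s ∈ Finset.range q, (ω ^ p) ^ (s * (q - y₀.val)) *
      ∑ xy : ZMod p × ZMod q,
        (ε xy : ℂ) * ((ω ^ q) ^ xy.1.val * (ω ^ xy.2.val * (ω ^ p) ^ (s * xy.2.val))) = 0 :=
    Finset.sum_eq_zero fun s _ => by rw [hconj s, mul_zero]
  have hswap : ∑ s ∈ Finset.range q, (ω ^ p) ^ (s * (q - y₀.val)) *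
      ∑ xy : ZMod p × ZMod q,
        (ε xy : ℂ) * ((ω ^ q) ^ xy.1.val * (ω ^ xy.2.val * (ω ^ p) ^ (s * xy.2.val))) =
      ∑ xy : ZMod p × ZMod q, (ε xy : ℂ) * ((ω ^ q) ^ xy.1.val * ω ^ xy.2.val) *
        ∑ s ∈ Finset.range q, ((ω ^ p) ^ (xy.2.val + (q - y₀.val))) ^ s := by
    simp_rw [Finset.mul_sum]
    rw [Finset.sum_comm]
    refine Finset.sum_congr rfl fun xy _ => ?_
    refine Finset.sum_congr rfl fun s _ => ?_
    ring
  rw [hswap, Fintype.sum_prod_type_right, Finset.sum_eq_single y₀] at hsum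
  · simp only [hgeom_self] at hsum
    have hfac : ∑ x : ZMod p, (ε (x, y₀) : ℂ) * ((ω ^ q) ^ x.val * ω ^ y₀.val) * (q : ℂ) =
        ((q : ℂ) * ω ^ y₀.val) * ∑ x : ZMod p, (ε (x, y₀) : ℂ) * (ω ^ q) ^ x.val := by
      rw [Finset.mul_sum]
      refine Finset.sum_congr rfl fun x _ => ?_
      ring
    rw [hfac, mul_eq_zero] at hsum
    rcases hsum with h | h
    · exact absurd h (mul_ne_zero (Nat.cast_ne_zero.2 hq0.ne') (pow_ne_zero _ hω0))
    · exact h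
  · intro y _ hy
    simp only [hgeom_ne y hy, mul_zero, Finset.sum_const_zero]
  · intro h; exact absurd (Finset.mem_univ _) h

/-- **The rational relations among the `pq`-th roots of unity, `q = p^m`, in the digits `b = qx + y`**: for a
primitive `pq`-th root of unity `ω` and integers `ε(x,y)` (`x ∈ ℤ/p`, `y ∈ ℤ/q`),
`Σ_{x,y} ε(x,y) ω^{qx+y} = 0` iff `ε(x,y)` does not depend on `x` — `Φ_{p^{m+1}}(X) = Φ_p(X^{p^m})`: the
relation module of the `p^{m+1}`-th roots of unity is spanned by the cosets of the subgroup of order `p`.  The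
case `m = 1` is the companion file's `PrimeSq.pairSum_pow_left_eq_zero_iff`; `m = 0` is Hazama's "(4.4) ⟺ (4.5)".
[cite: Hazama2003CyclicCM, Prop. 4.3 (proof, (4.4)–(4.5))] -/
theorem pairSum_pow_left_eq_zero_iff {m : ℕ} (hqm : q = p ^ m) {ω : ℂ} (hω : IsPrimitiveRoot ω (p * q))
    (ε : ZMod p × ZMod q → ℤ) :
    pairSum ε (ω ^ q) ω = 0 ↔ ∀ (x x' : ZMod p) (y : ZMod q), ε (x, y) = ε (x', y) := by
  haveI : NeZero p := ⟨hp.out.ne_zero⟩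
  have hn : 0 < p * q := Nat.mul_pos hp.out.pos (Nat.pos_of_ne_zero (NeZero.ne q))
  have hν : IsPrimitiveRoot (ω ^ q) p := hω.pow hn (mul_comm p q)
  constructor
  · intro h0 x x' y
    have hrow := sum_row_mul_pow_eq_zero hqm hω ε h0 y
    have hrow' : ∑ j : ZMod p, (((ε (j, y) : ℚ)) : ℂ) * (ω ^ q) ^ j.val = 0 := by
      simpa only [Rat.cast_intCast] using hrow
    have := (sum_mul_pow_eq_zero_iff_forall_eq hν (fun j => (ε (j, y) : ℚ))).1 hrow' x x'
    exact_mod_cast this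
  · intro h
    unfold pairSum
    rw [Fintype.sum_prod_type_right]
    refine Finset.sum_eq_zero fun y _ => ?_
    have : ∑ x : ZMod p, (ε (x, y) : ℂ) * ((ω ^ q) ^ x.val * ω ^ y.val) =
        ((ε (0, y) : ℂ) * ω ^ y.val) * ∑ x : ZMod p, (ω ^ q) ^ x.val := by
      rw [Finset.mul_sum]
      refine Finset.sum_congr rfl fun x _ => ?_
      rw [h x 0 y]
      ring
    rw [this, sum_pow_val_eq_zero hν, mul_zero]

/-! ### Digits `b = qu + y`: the one-variable form of the relation lemma -/

omit hq in
/-- Digits are unique: `qu + y = qu' + y'` with `y, y' < q` forces `u = u'`, `y = y'`. [folklore] -/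
private theorem digits_inj {u u' y y' : ℕ} (hy : y < q) (hy' : y' < q) (h : q * u + y = q * u' + y') :
    u = u' ∧ y = y' := by
  have hq0 : 0 < q := by omega
  have e2 : y = y' := by
    have := congrArg (· % q) h
    simpa only [Nat.mul_add_mod, Nat.mod_eq_of_lt hy, Nat.mod_eq_of_lt hy'] using this
  have e1 : u = u' := by
    have := congrArg (· / q) h
    simpa only [Nat.mul_add_div hq0, Nat.div_eq_of_lt hy, Nat.div_eq_of_lt hy', add_zero] using this
  exact ⟨e1, e2⟩

omit hq hp in
/-- `qu + y < pq` for `u < p`, `y < q`. [folklore] -/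
private theorem digits_lt {u y : ℕ} (hu : u < p) (hy : y < q) : q * u + y < p * q := by
  have h1 : q * u + y < q * u + q := by omega
  have h2 : q * u + q = q * (u + 1) := by ring
  have h3 : q * (u + 1) ≤ q * p := Nat.mul_le_mul_left q hu
  rw [mul_comm p q]; omega

/-- **The digit map `(u, y) ↦ qu + y : ℤ/p × ℤ/q → ℤ/pq` is a bijection.** [folklore] -/
private theorem digit_bijective :
    Function.Bijective fun uy : ZMod p × ZMod q => ((q * uy.1.val + uy.2.val : ℕ) : ZMod (p * q)) := by
  haveI : NeZero p := ⟨hp.out.ne_zero⟩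
  haveI : NeZero (p * q) := ⟨mul_ne_zero hp.out.ne_zero (NeZero.ne q)⟩
  rw [Fintype.bijective_iff_injective_and_card]
  refine ⟨?_, by rw [Fintype.card_prod, ZMod.card, ZMod.card, ZMod.card]⟩
  rintro ⟨u, y⟩ ⟨u', y'⟩ h
  simp only at h
  rw [ZMod.natCast_eq_natCast_iff'] at h
  rw [Nat.mod_eq_of_lt (digits_lt (ZMod.val_lt u) (ZMod.val_lt y)),
    Nat.mod_eq_of_lt (digits_lt (ZMod.val_lt u') (ZMod.val_lt y'))] at h
  obtain ⟨e1, e2⟩ := digits_inj (ZMod.val_lt y) (ZMod.val_lt y') h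
  exact Prod.ext (ZMod.val_injective p e1) (ZMod.val_injective q e2)

/-- The value of the digit `qu + y` is `qu + y`. [folklore] -/
private theorem val_digit (u : ZMod p) (y : ZMod q) :
    (((q * u.val + y.val : ℕ) : ZMod (p * q))).val = q * u.val + y.val := by
  haveI : NeZero (p * q) := ⟨mul_ne_zero hp.out.ne_zero (NeZero.ne q)⟩
  rw [ZMod.val_natCast, Nat.mod_eq_of_lt (digits_lt (ZMod.val_lt u) (ZMod.val_lt y))]

omit hq in
/-- Incrementing the top digit adds `q`: `q(u+1) + y = (qu + y) + q` in `ℤ/pq`. [folklore] -/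
private theorem digit_succ (u : ZMod p) (y : ZMod q) :
    (((q * (u + 1).val + y.val : ℕ) : ZMod (p * q))) = ((q * u.val + y.val : ℕ) : ZMod (p * q)) + q := by
  haveI : NeZero p := ⟨hp.out.ne_zero⟩
  have hpq : (p : ZMod (p * q)) * q = 0 := by exact_mod_cast ZMod.natCast_self (p * q)
  have hval : (u + 1).val + p * ((u.val + 1) / p) = u.val + 1 := by
    rw [ZMod.val_add, ZMod.val_one_eq_one_mod, Nat.add_mod_mod]
    exact Nat.mod_add_div _ _
  have hcast := congrArg (Nat.cast : ℕ → ZMod (p * q)) hval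
  push_cast at hcast ⊢
  have e : ((u + 1).val : ZMod (p * q)) = u.val + 1 - p * (((u.val + 1) / p : ℕ) : ZMod (p * q)) := by
    rw [← hcast]; ring
  rw [e]
  linear_combination (-(((u.val + 1) / p : ℕ) : ZMod (p * q))) * hpq

/-- **Relations among the `p^{m+1}`-th roots of unity, one-variable form**: for a primitive `pq`-th root of unity
`ω` (`q = p^m`) and integers `f(c)`, `c ∈ ℤ/pq`, `Σ_c f(c) ω^c = 0` iff `f(c + q) = f(c)` for all `c` — `f` is
constant on the cosets of the subgroup `qℤ/pqℤ` of order `p`. [cite: Hazama2003CyclicCM, Prop. 4.3 (proof, (4.4)–(4.5))] -/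
theorem sum_mul_pow_eq_zero_iff_periodic {m n : ℕ} [NeZero n] (hqm : q = p ^ m) (hn : n = p * q) {ω : ℂ}
    (hω : IsPrimitiveRoot ω n) (f : ZMod n → ℤ) :
    ∑ c : ZMod n, (f c : ℂ) * ω ^ c.val = 0 ↔ ∀ c : ZMod n, f (c + q) = f c := by
  subst hn
  haveI : NeZero p := ⟨hp.out.ne_zero⟩
  haveI : NeZero (p * q) := ⟨mul_ne_zero hp.out.ne_zero (NeZero.ne q)⟩
  set d : ZMod p × ZMod q → ZMod (p * q) := fun uy => ((q * uy.1.val + uy.2.val : ℕ) : ZMod (p * q)) with hd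
  have hbij : Function.Bijective d := digit_bijective
  -- reindex the sum by the digits
  have hsum : ∑ c : ZMod (p * q), (f c : ℂ) * ω ^ c.val = pairSum (fun uy => f (d uy)) (ω ^ q) ω := by
    unfold pairSum
    rw [← Fintype.sum_bijective d hbij (fun uy => (f (d uy) : ℂ) * ((ω ^ q) ^ uy.1.val * ω ^ uy.2.val))
      (fun c => (f c : ℂ) * ω ^ c.val) fun uy => ?_]
    rw [hd]
    simp only
    rw [val_digit, pow_add, pow_mul]
  rw [hsum, pairSum_pow_left_eq_zero_iff hqm hω]
  constructor
  · intro H c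
    obtain ⟨⟨u, y⟩, rfl⟩ := hbij.2 c
    have e : d (u, y) + q = d (u + 1, y) := by rw [hd]; exact (digit_succ u y).symm
    rw [e]
    exact H (u + 1) u y
  · intro H
    -- `u ↦ f (d (u, y))` is invariant under `u ↦ u + 1`, hence constant
    have step : ∀ (u : ZMod p) (y : ZMod q), f (d (u + 1, y)) = f (d (u, y)) := fun u y => by
      have e : d (u + 1, y) = d (u, y) + q := by rw [hd]; exact digit_succ u y
      rw [e, H]
    have hn : ∀ (n : ℕ) (y : ZMod q), f (d ((n : ZMod p), y)) = f (d (0, y)) := by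
      intro n y
      induction n with
      | zero => rw [Nat.cast_zero]
      | succ n ih => rw [Nat.cast_succ, step, ih]
    intro u u' y
    rw [← ZMod.natCast_zmod_val u, ← ZMod.natCast_zmod_val u', hn, hn]

end Roots

/-! ## §2 The group `⟨ρ⟩ × ⟨σ⟩`, `σ` of order `AB`, in the digits `(x, c) ↦ σ^{Bx+c}` -/

section Digits

variable {G : Type*} [CommGroup G] [Fintype G] [DecidableEq G] {A B : ℕ} [hA : NeZero A] [hB : NeZero B]
  {ρ σ : G} {Φ : Finset G}

omit [Fintype G] [DecidableEq G] hA hB in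
/-- `(σ^B)ˣ σᶜ = σ^{Bx + c}`. [folklore] -/
private theorem pow_pow_mul_pow (x c : ℕ) : (σ ^ B) ^ x * σ ^ c = σ ^ (B * x + c) := by
  rw [← pow_mul, ← pow_add]

omit [Fintype G] [DecidableEq G] hA hB in
/-- In `⟨ρ⟩ × ⟨σ⟩` no element `ρσⁱ` is a power of `σ`. [folklore] -/
private theorem rho_mul_pow_ne_pow (hρσ : ρ ∉ Subgroup.zpowers σ) (i j : ℕ) : ρ * σ ^ j ≠ σ ^ i := by
  intro h
  apply hρσ
  have : ρ = σ ^ i * (σ ^ j)⁻¹ := by rw [← h, mul_inv_cancel_right]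
  rw [this]
  exact mul_mem (pow_mem (Subgroup.mem_zpowers σ) i) (inv_mem (pow_mem (Subgroup.mem_zpowers σ) j))

omit [Fintype G] [DecidableEq G] in
/-- **`(x, c) ↦ σ^{Bx+c}` is injective on `ℤ/A × ℤ/B`** for `σ` of order `AB`. [folklore] -/
private theorem pow_pow_mul_pow_injective (hσ : orderOf σ = A * B) :
    Function.Injective fun xc : ZMod A × ZMod B => (σ ^ B) ^ xc.1.val * σ ^ xc.2.val := by
  rintro ⟨x, c⟩ ⟨x', c'⟩ h
  have h' : σ ^ (B * x.val + c.val) = σ ^ (B * x'.val + c'.val) := by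
    simpa only [pow_pow_mul_pow] using h
  rw [pow_eq_pow_iff_modEq, hσ] at h'
  have hlt : ∀ (a : ZMod A) (b : ZMod B), B * a.val + b.val < A * B := fun a b => by
    have h1 : B * a.val + b.val < B * a.val + B := by have := ZMod.val_lt b; omega
    have h2 : B * a.val + B = B * (a.val + 1) := by ring
    have h3 : B * (a.val + 1) ≤ B * A := Nat.mul_le_mul_left B (ZMod.val_lt a)
    rw [mul_comm A B]; omega
  have heq : B * x.val + c.val = B * x'.val + c'.val := Nat.ModEq.eq_of_lt_of_lt h' (hlt x c) (hlt x' c')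
  have hB0 : 0 < B := Nat.pos_of_ne_zero (NeZero.ne B)
  have e2 : c.val = c'.val := by
    have := congrArg (· % B) heq
    simpa only [Nat.mul_add_mod, Nat.mod_eq_of_lt (ZMod.val_lt c), Nat.mod_eq_of_lt (ZMod.val_lt c')] using this
  have e1 : x.val = x'.val := by
    have := congrArg (· / B) heq
    simpa only [Nat.mul_add_div hB0, Nat.div_eq_of_lt (ZMod.val_lt c), Nat.div_eq_of_lt (ZMod.val_lt c'),
      add_zero] using this
  exact Prod.ext (ZMod.val_injective A e1) (ZMod.val_injective B e2)

omit [DecidableEq G] in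
/-- **The digits of `G`**: `(x, c) ↦ σ^{Bx+c}` together with `(x, c) ↦ ρσ^{Bx+c}` is a bijection
`(ℤ/A × ℤ/B) ⊔ (ℤ/A × ℤ/B) → G` (`σ` of order `AB`, `ρ ∉ ⟨σ⟩`, `|G| = 2AB`). [cite: Dodson1987, §4.1 (the minimal group `⟨ρ⟩ × ℤ₉`)] -/
theorem coord_bijective (hσ : orderOf σ = A * B) (hρσ : ρ ∉ Subgroup.zpowers σ)
    (hcard : Fintype.card G = 2 * (A * B)) :
    Function.Bijective fun s : (ZMod A × ZMod B) ⊕ (ZMod A × ZMod B) =>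
      Sum.elim (fun xc => (σ ^ B) ^ xc.1.val * σ ^ xc.2.val)
        (fun xc => ρ * ((σ ^ B) ^ xc.1.val * σ ^ xc.2.val)) s := by
  rw [Fintype.bijective_iff_injective_and_card]
  refine ⟨?_, by rw [Fintype.card_sum, Fintype.card_prod, ZMod.card, ZMod.card, hcard, two_mul]⟩
  rintro (a | a) (b | b) hab <;> simp only [Sum.elim_inl, Sum.elim_inr] at hab
  · exact congrArg Sum.inl (pow_pow_mul_pow_injective hσ hab)
  · rw [pow_pow_mul_pow, pow_pow_mul_pow] at hab
    exact absurd hab.symm (rho_mul_pow_ne_pow hρσ _ _)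
  · rw [pow_pow_mul_pow, pow_pow_mul_pow] at hab
    exact absurd hab (rho_mul_pow_ne_pow hρσ _ _)
  · exact congrArg Sum.inr (pow_pow_mul_pow_injective hσ (mul_left_cancel hab))

omit [DecidableEq G] in
/-- Every `g ∈ G` is `σ^{Bx+c}` or `ρσ^{Bx+c}`. [cite: Dodson1987, §4.1] -/
theorem exists_coord (hσ : orderOf σ = A * B) (hρσ : ρ ∉ Subgroup.zpowers σ)
    (hcard : Fintype.card G = 2 * (A * B)) (g : G) :
    ∃ xc : ZMod A × ZMod B, g = (σ ^ B) ^ xc.1.val * σ ^ xc.2.val ∨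
      g = ρ * ((σ ^ B) ^ xc.1.val * σ ^ xc.2.val) := by
  obtain ⟨s, h⟩ := (coord_bijective hσ hρσ hcard).2 g
  rcases s with xc | xc
  · exact ⟨xc, Or.inl (by simpa using h.symm)⟩
  · exact ⟨xc, Or.inr (by simpa using h.symm)⟩

omit [Fintype G] [DecidableEq G] hA hB in
/-- `χ(gh) = χ(g)χ(h)`. [folklore] -/
private theorem char_mul (χ : AddChar (Additive G) ℂ) (g h : G) :
    χ (Additive.ofMul (g * h)) = χ (Additive.ofMul g) * χ (Additive.ofMul h) := by
  rw [ofMul_mul, AddChar.map_add_eq_mul]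

omit [Fintype G] [DecidableEq G] hA hB in
/-- `χ(gᵉ) = χ(g)ᵉ`. [folklore] -/
private theorem char_pow (χ : AddChar (Additive G) ℂ) (g : G) (e : ℕ) :
    χ (Additive.ofMul (g ^ e)) = χ (Additive.ofMul g) ^ e := by
  rw [ofMul_pow, AddChar.map_nsmul_eq_pow]

/-- **The character sum of a type in the digits `σ^{Bx+c}`**: for an ODD character `χ` and a CM type `S`,
`Σ_{s∈S} χ(s) = V(E(S); χ(σ)^B, χ(σ))` with `E(S)(x,c) = ±1` according as `σ^{Bx+c} ∈ S` (the tree's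
`signMatrix A B S (σ^B) σ`). [cite: Hazama2003CyclicCM, Prop. 4.1 and (4.1)] [cite: Kubota1965, §4 Lemma 2] -/
theorem sum_char_eq_pairSum (hσ : orderOf σ = A * B) (hρσ : ρ ∉ Subgroup.zpowers σ)
    (hcard : Fintype.card G = 2 * (A * B)) (h : IsCMTypeWith ρ (Φ : Set G)) (χ : AddChar (Additive G) ℂ)
    (hχ : χ (Additive.ofMul ρ) = -1) :
    ∑ s ∈ Φ, χ (Additive.ofMul s) =
      pairSum (signMatrix A B Φ (σ ^ B) σ) (χ (Additive.ofMul σ) ^ B) (χ (Additive.ofMul σ)) := by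
  set e : (ZMod A × ZMod B) ⊕ (ZMod A × ZMod B) → G := fun s =>
    Sum.elim (fun xc => (σ ^ B) ^ xc.1.val * σ ^ xc.2.val)
      (fun xc => ρ * ((σ ^ B) ^ xc.1.val * σ ^ xc.2.val)) s with he
  have hbij : Function.Bijective e := coord_bijective hσ hρσ hcard
  have h1 : ∑ s ∈ Φ, χ (Additive.ofMul s) = ∑ g : G, if g ∈ Φ then χ (Additive.ofMul g) else 0 := by
    rw [← Finset.sum_filter, Finset.filter_mem_eq_inter, Finset.univ_inter]
  have h2 : (∑ g : G, if g ∈ Φ then χ (Additive.ofMul g) else 0) =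
      ∑ s : (ZMod A × ZMod B) ⊕ (ZMod A × ZMod B), if e s ∈ Φ then χ (Additive.ofMul (e s)) else 0 :=
    (Fintype.sum_bijective e hbij (fun s => if e s ∈ Φ then χ (Additive.ofMul (e s)) else 0)
      (fun g => if g ∈ Φ then χ (Additive.ofMul g) else 0) fun _ => rfl).symm
  rw [h1, h2, Fintype.sum_sum_type]
  unfold pairSum
  rw [← Finset.sum_add_distrib]
  refine Finset.sum_congr rfl fun xc _ => ?_
  have hval : χ (Additive.ofMul ((σ ^ B) ^ xc.1.val * σ ^ xc.2.val)) =
      (χ (Additive.ofMul σ) ^ B) ^ xc.1.val * χ (Additive.ofMul σ) ^ xc.2.val := by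
    rw [char_mul, char_pow, char_pow, char_pow]
  simp only [he, Sum.elim_inl, Sum.elim_inr]
  unfold signMatrix typeSign
  by_cases hm : (σ ^ B) ^ xc.1.val * σ ^ xc.2.val ∈ Φ
  · have hm' : ρ * ((σ ^ B) ^ xc.1.val * σ ^ xc.2.val) ∉ Φ := fun h' => (rho_mul_mem_iff h _).1 h' hm
    rw [if_neg hm', if_pos hm, if_pos hm, hval, add_zero, Int.cast_one, one_mul]
  · have hm' : ρ * ((σ ^ B) ^ xc.1.val * σ ^ xc.2.val) ∈ Φ := (rho_mul_mem_iff h _).2 hm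
    rw [if_pos hm', if_neg hm, if_neg hm, char_mul, hχ, hval, zero_add]
    push_cast
    ring

omit [Fintype G] in
/-- `V(ε; 1, ν) = Σ_c (Σ_x ε(x,c)) ν^c`: a character trivial on `σ^B` sees only the row sums of `E(S)`.
[cite: Hazama2003CyclicCM, Prop. 4.3 (proof)] -/
theorem pairSum_one_left_eq (ε : ZMod A × ZMod B → ℤ) (ν : ℂ) :
    pairSum ε 1 ν = ∑ c : ZMod B, ((∑ x : ZMod A, ε (x, c) : ℤ) : ℂ) * ν ^ c.val := by
  unfold pairSum
  rw [Fintype.sum_prod_type_right]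
  refine Fintype.sum_congr _ _ fun c => ?_
  push_cast
  rw [Finset.sum_mul]
  refine Fintype.sum_congr _ _ fun x => ?_
  rw [one_pow, one_mul]

end Digits

/-! ## §3 The levels: an odd character of order `2p^{i+1}` vanishes iff the counts on the cosets of `⟨σ^{p^{i+1}}⟩`
are invariant under `σ^{p^i}` -/

section Levels

variable {G : Type*} [CommGroup G] [Fintype G] [DecidableEq G] {p : ℕ} [hp : Fact p.Prime] {k : ℕ} {ρ σ : G}
  {Φ : Finset G}

omit [Fintype G] [DecidableEq G] in
/-- `ρ² = 1` for the conjugation of a CM type. [folklore] -/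
private theorem rho_mul_rho (h : IsCMTypeWith ρ (Φ : Set G)) : ρ * ρ = 1 := by
  have := h.invol (1 : G)
  simpa [smul_eq_mul] using this

omit [Fintype G] [DecidableEq G] in
/-- `ρ ≠ 1` for the conjugation of a CM type. [folklore] -/
private theorem rho_ne_one (h : IsCMTypeWith ρ (Φ : Set G)) : ρ ≠ 1 := by
  intro hρ
  have := h.rho_smul_ne (1 : G)
  rw [hρ, smul_eq_mul, one_mul] at this
  exact this rfl

omit [Fintype G] [DecidableEq G] hp in
/-- `σ` of order `p^k` has order `p^{k−(i+1)} · p^{i+1}` (`i < k`): the digits of level `i + 1`. [folklore] -/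
private theorem orderOf_eq_level (hσ : orderOf σ = p ^ k) {i : ℕ} (hi : i < k) :
    orderOf σ = p ^ (k - (i + 1)) * p ^ (i + 1) := by
  rw [hσ, ← pow_add, Nat.sub_add_cancel hi]

omit [Fintype G] [DecidableEq G] hp in
/-- `χ(σ)^{p^k} = 1` for `σ` of order `p^k`. [folklore] -/
private theorem char_pow_orderOf_eq_one (hσ : orderOf σ = p ^ k) (χ : AddChar (Additive G) ℂ) :
    χ (Additive.ofMul σ) ^ (p ^ k) = 1 := by
  rw [← char_pow, ← hσ, pow_orderOf_eq_one, ofMul_one, AddChar.map_zero_eq_one]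

/-- **The odd character of order `2` never vanishes on a type** (`χ(σ) = 1`: `χ(S)` is a sum of `p^k` signs, an
odd integer). [cite: Hazama2003CyclicCM, Prop. 4.2] [cite: Kubota1965, §4 Lemma 2] -/
theorem sum_char_ne_zero_of_apply_eq_one (hp2 : p ≠ 2) (hσ : orderOf σ = p ^ k)
    (hρσ : ρ ∉ Subgroup.zpowers σ) (hcard : Fintype.card G = 2 * p ^ k) (h : IsCMTypeWith ρ (Φ : Set G))
    (χ : AddChar (Additive G) ℂ) (hχ : χ (Additive.ofMul ρ) = -1) (hω : χ (Additive.ofMul σ) = 1) :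
    ∑ s ∈ Φ, χ (Additive.ofMul s) ≠ 0 := by
  have hσ' : orderOf σ = 1 * p ^ k := by rw [one_mul, hσ]
  have hcard' : Fintype.card G = 2 * (1 * p ^ k) := by rw [one_mul, hcard]
  rw [sum_char_eq_pairSum hσ' hρσ hcard' h χ hχ, hω, one_pow, pairSum_one_left_eq]
  simp only [one_pow, mul_one]
  rw [← Int.cast_sum, Int.cast_ne_zero]
  simp_rw [sum_signMatrix_row]
  rw [Finset.sum_sub_distrib, Finset.sum_const, Finset.card_univ, ZMod.card, ← Finset.mul_sum, nsmul_eq_mul,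
    Nat.cast_one, mul_one]
  obtain ⟨m, hm⟩ : Odd (p ^ k) := (hp.out.odd_of_ne_two hp2).pow
  have hm' : ((p ^ k : ℕ) : ℤ) = 2 * m + 1 := by exact_mod_cast hm
  omega

/-- **THE LEVELS.**  For an odd character `χ` whose value `ω = χ(σ)` has order EXACTLY `p^{i+1}` (`i < k`):
`χ(S) = 0` iff the counts `N(c) = #(S ∩ σᶜ⟨σ^{p^{i+1}}⟩)` of `S` on the `p^{i+1}` cosets of the subgroup
`⟨σ^{p^{i+1}}⟩` (of order `p^{k−i−1}`) are invariant under `c ↦ c + p^i` — i.e. `S` is EQUIDISTRIBUTED among the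
`p` cosets of `⟨σ^{p^{i+1}}⟩` inside each coset of `⟨σ^{p^i}⟩` ("the equations (4.4) are equivalent to the condition
(4.5) that `#{a ∈ R_i ; e_a = 1}` does not depend on `i`", at level `p^{i+1}`; for `i + 1 = k` this is
`σ^{p^{k−1}}S = S`, for `i = 0` constant counts on the cosets of `⟨σ^p⟩`).  Here
`N(c) = rowCount (p^{k−i−1}) (p^{i+1}) S (σ^{p^{i+1}}) σ c`. [cite: Hazama2003CyclicCM, Prop. 4.3 and Lemma 4.6.1]
[cite: Dodson1987, Prop. 4.4 (1)] -/
theorem sum_char_eq_zero_iff_level (hσ : orderOf σ = p ^ k) (hρσ : ρ ∉ Subgroup.zpowers σ)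
    (hcard : Fintype.card G = 2 * p ^ k) (h : IsCMTypeWith ρ (Φ : Set G)) (χ : AddChar (Additive G) ℂ)
    (hχ : χ (Additive.ofMul ρ) = -1) {i : ℕ} (hi : i < k) (hωi1 : χ (Additive.ofMul σ) ^ p ^ (i + 1) = 1)
    (hωi : χ (Additive.ofMul σ) ^ p ^ i ≠ 1) :
    ∑ s ∈ Φ, χ (Additive.ofMul s) = 0 ↔ ∀ c : ZMod (p ^ (i + 1)),
      rowCount (p ^ (k - (i + 1))) (p ^ (i + 1)) Φ (σ ^ p ^ (i + 1)) σ (c + (p ^ i : ℕ)) =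
        rowCount (p ^ (k - (i + 1))) (p ^ (i + 1)) Φ (σ ^ p ^ (i + 1)) σ c := by
  have hprim : IsPrimitiveRoot (χ (Additive.ofMul σ)) (p ^ (i + 1)) :=
    IsPrimitiveRoot.iff_orderOf.2 (orderOf_eq_prime_pow hωi hωi1)
  rw [sum_char_eq_pairSum (orderOf_eq_level hσ hi) hρσ
      (show Fintype.card G = 2 * (p ^ (k - (i + 1)) * p ^ (i + 1)) by rw [hcard, ← pow_add, Nat.sub_add_cancel hi])
      h χ hχ, hωi1,
    pairSum_one_left_eq, sum_mul_pow_eq_zero_iff_periodic (p := p) (q := p ^ i) (m := i) rfl (pow_succ' p i)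
      hprim]
  simp_rw [sum_signMatrix_row]
  constructor
  · intro H c; have := H c; omega
  · intro H c; rw [H c]

end Levels

/-! ## §4 Counting the vanishing odd characters: `φ(p^{i+1})` for each level with equidistribution -/

section Defect

variable {G : Type*} [CommGroup G] [Fintype G] [DecidableEq G] {p : ℕ} [hp : Fact p.Prime] {k : ℕ} {ρ σ : G}
  {Φ : Finset G}

open Dodson1984 (ncard_oddChar)

omit [DecidableEq G] in
/-- **An odd character of `⟨ρ⟩ × ⟨σ⟩` is determined by its value at `σ`.** [folklore] -/
private theorem oddChar_injOn (hσ : orderOf σ = p ^ k) (hρσ : ρ ∉ Subgroup.zpowers σ)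
    (hcard : Fintype.card G = 2 * p ^ k) :
    Set.InjOn (fun χ : AddChar (Additive G) ℂ => χ (Additive.ofMul σ))
      {χ : AddChar (Additive G) ℂ | χ (Additive.ofMul ρ) = -1} := by
  have hσ' : orderOf σ = 1 * p ^ k := by rw [one_mul, hσ]
  have hcard' : Fintype.card G = 2 * (1 * p ^ k) := by rw [one_mul, hcard]
  intro χ₁ h₁ χ₂ h₂ heq
  simp only [Set.mem_setOf_eq] at h₁ h₂ heq
  refine DFunLike.ext _ _ fun a => ?_
  obtain ⟨⟨x, c⟩, hx | hx⟩ := exists_coord hσ' hρσ hcard' (Additive.toMul a)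
  · have : a = Additive.ofMul ((σ ^ p ^ k) ^ x.val * σ ^ c.val) := by rw [← hx]; rfl
    simp only [this, char_mul, char_pow, heq]
  · have : a = Additive.ofMul (ρ * ((σ ^ p ^ k) ^ x.val * σ ^ c.val)) := by rw [← hx]; rfl
    simp only [this, char_mul, char_pow, h₁, h₂, heq]

/-- The `m`-th roots of unity in `ℂ` as a set are the finset `nthRootsFinset m 1`. [folklore] -/
private theorem setOf_pow_eq_one_eq_coe_nthRootsFinset {m : ℕ} (hm : 0 < m) :
    {ω : ℂ | ω ^ m = 1} = ↑(Polynomial.nthRootsFinset m (1 : ℂ)) := by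
  ext ω
  rw [Set.mem_setOf_eq, Finset.mem_coe, Polynomial.mem_nthRootsFinset hm]

/-- `#{ω ∈ ℂ : ωᵐ = 1} = m` (`m ≥ 1`). [folklore] -/
private theorem ncard_setOf_pow_eq_one {m : ℕ} (hm : 0 < m) : {ω : ℂ | ω ^ m = 1}.ncard = m := by
  rw [setOf_pow_eq_one_eq_coe_nthRootsFinset hm, Set.ncard_coe_finset,
    (Complex.isPrimitiveRoot_exp m hm.ne').card_nthRootsFinset]

omit [DecidableEq G] in
/-- **`χ ↦ χ(σ)` maps the odd characters ONTO the `p^k`-th roots of unity.** [folklore] -/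
private theorem image_oddChar_eq (hσ : orderOf σ = p ^ k) (hρσ : ρ ∉ Subgroup.zpowers σ)
    (hcard : Fintype.card G = 2 * p ^ k) (hρ1 : ρ ≠ 1) (hρ2 : ρ * ρ = 1) :
    (fun χ : AddChar (Additive G) ℂ => χ (Additive.ofMul σ)) ''
        {χ : AddChar (Additive G) ℂ | χ (Additive.ofMul ρ) = -1} = {ω : ℂ | ω ^ (p ^ k) = 1} := by
  have hn : 0 < p ^ k := pow_pos hp.out.pos k
  apply Set.eq_of_subset_of_ncard_le
  · rintro _ ⟨χ, -, rfl⟩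
    exact char_pow_orderOf_eq_one hσ χ
  · rw [(oddChar_injOn hσ hρσ hcard).ncard_image, ncard_oddChar hρ1 hρ2 hcard, ncard_setOf_pow_eq_one hn]
  · rw [setOf_pow_eq_one_eq_coe_nthRootsFinset hn]
    exact Finset.finite_toSet _

/-- **`#{ω : ω^{p^{i+1}} = 1, ω^{p^i} ≠ 1} = p^{i+1} − p^i = φ(p^{i+1})`** (the roots of unity of order exactly
`p^{i+1}`). [folklore] -/
private theorem ncard_setOf_order_eq (i : ℕ) :
    {ω : ℂ | ω ^ p ^ (i + 1) = 1 ∧ ω ^ p ^ i ≠ 1}.ncard = p ^ (i + 1) - p ^ i := by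
  have hsub : {ω : ℂ | ω ^ p ^ i = 1} ⊆ {ω : ℂ | ω ^ p ^ (i + 1) = 1} := by
    intro ω hω
    simp only [Set.mem_setOf_eq] at hω ⊢
    rw [pow_succ, pow_mul, hω, one_pow]
  have hset : {ω : ℂ | ω ^ p ^ (i + 1) = 1 ∧ ω ^ p ^ i ≠ 1} =
      {ω : ℂ | ω ^ p ^ (i + 1) = 1} \ {ω : ℂ | ω ^ p ^ i = 1} := by
    ext ω
    simp only [Set.mem_setOf_eq, Set.mem_sdiff]
  have hfin : {ω : ℂ | ω ^ p ^ (i + 1) = 1}.Finite := by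
    rw [setOf_pow_eq_one_eq_coe_nthRootsFinset (pow_pos hp.out.pos _)]
    exact Finset.finite_toSet _
  rw [hset, Set.ncard_sdiff hsub (hfin.subset hsub), ncard_setOf_pow_eq_one (pow_pos hp.out.pos _),
    ncard_setOf_pow_eq_one (pow_pos hp.out.pos _)]

/-- **The level of a non-trivial `p^k`-th root of unity**: `ω ≠ 1` with `ω^{p^k} = 1` has order exactly `p^{i+1}`
for a unique `i < k`. [folklore] -/
private theorem existsUnique_level {ω : ℂ} (hωk : ω ^ p ^ k = 1) (hω1 : ω ≠ 1) :
    ∃! i : ℕ, i < k ∧ ω ^ p ^ (i + 1) = 1 ∧ ω ^ p ^ i ≠ 1 := by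
  obtain ⟨e, hek, he⟩ := (Nat.dvd_prime_pow hp.out).1 (orderOf_dvd_of_pow_eq_one hωk)
  have he0 : e ≠ 0 := by
    rintro rfl
    rw [pow_zero, orderOf_eq_one_iff] at he
    exact hω1 he
  obtain ⟨i, rfl⟩ := Nat.exists_eq_add_one_of_ne_zero he0
  refine ⟨i, ⟨by omega, by rw [← he]; exact pow_orderOf_eq_one ω, fun h1 => ?_⟩, ?_⟩
  · have hdvd := orderOf_dvd_of_pow_eq_one h1
    rw [he] at hdvd
    have := Nat.le_of_dvd (pow_pos hp.out.pos i) hdvd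
    have hlt : p ^ i < p ^ (i + 1) := Nat.pow_lt_pow_right hp.out.one_lt (by omega)
    omega
  · rintro i' ⟨-, h1', h2'⟩
    have := orderOf_eq_prime_pow h2' h1'
    rw [he] at this
    exact (Nat.succ_injective (Nat.pow_right_injective hp.out.two_le this)).symm

/-- **The vanishing criterion for an arbitrary odd character**, all levels together: `χ(S) = 0` iff, for the
level `i + 1` of `ω = χ(σ)` (`ω` of order exactly `p^{i+1}`, `i < k`), the counts of `S` on the cosets of
`⟨σ^{p^{i+1}}⟩` are invariant under `σ^{p^i}`. [cite: Kubota1965, §4 Lemma 2] [cite: Hazama2003CyclicCM, Prop. 4.3 and Lemma 4.6.1] -/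
theorem sum_char_eq_zero_iff (hp2 : p ≠ 2) (hσ : orderOf σ = p ^ k) (hρσ : ρ ∉ Subgroup.zpowers σ)
    (hcard : Fintype.card G = 2 * p ^ k) (h : IsCMTypeWith ρ (Φ : Set G)) (χ : AddChar (Additive G) ℂ)
    (hχ : χ (Additive.ofMul ρ) = -1) :
    ∑ s ∈ Φ, χ (Additive.ofMul s) = 0 ↔ ∃ i : ℕ, i < k ∧
      χ (Additive.ofMul σ) ^ p ^ (i + 1) = 1 ∧ χ (Additive.ofMul σ) ^ p ^ i ≠ 1 ∧
        ∀ c : ZMod (p ^ (i + 1)),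
          rowCount (p ^ (k - (i + 1))) (p ^ (i + 1)) Φ (σ ^ p ^ (i + 1)) σ (c + (p ^ i : ℕ)) =
            rowCount (p ^ (k - (i + 1))) (p ^ (i + 1)) Φ (σ ^ p ^ (i + 1)) σ c := by
  by_cases hω1 : χ (Additive.ofMul σ) = 1
  · have hne := sum_char_ne_zero_of_apply_eq_one hp2 hσ hρσ hcard h χ hχ hω1
    simp only [hne, hω1, one_pow, ne_eq, not_true_eq_false, false_and, and_false, exists_false]
  · obtain ⟨i, ⟨hi, h1, h2⟩, huniq⟩ := existsUnique_level (char_pow_orderOf_eq_one hσ χ) hω1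
    rw [sum_char_eq_zero_iff_level hσ hρσ hcard h χ hχ hi h1 h2]
    constructor
    · intro H; exact ⟨i, hi, h1, h2, H⟩
    · rintro ⟨i', hi', h1', h2', H'⟩
      have := huniq i' ⟨hi', h1', h2'⟩
      subst this
      exact H'

open scoped Classical in
/-- **The number of odd characters vanishing on `S`** (Kubota's defect): `φ(p^{i+1}) = p^{i+1} − p^i` for each
level `i + 1 ≤ k` at which `S` is equidistributed. [cite: Kubota1965, §4 Lemma 2] [cite: Dodson1987, Prop. 4.4 (1)]
[cite: Hazama2003CyclicCM, Thm. 4.8] -/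
theorem ncard_oddChar_vanishing_eq (hp2 : p ≠ 2) (hσ : orderOf σ = p ^ k) (hρσ : ρ ∉ Subgroup.zpowers σ)
    (hcard : Fintype.card G = 2 * p ^ k) (h : IsCMTypeWith ρ (Φ : Set G)) :
    {χ : AddChar (Additive G) ℂ | χ (Additive.ofMul ρ) = -1 ∧ ∑ s ∈ Φ, χ (Additive.ofMul s) = 0}.ncard =
      ∑ i ∈ Finset.range k,
        if (∀ c : ZMod (p ^ (i + 1)),
            rowCount (p ^ (k - (i + 1))) (p ^ (i + 1)) Φ (σ ^ p ^ (i + 1)) σ (c + (p ^ i : ℕ)) =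
              rowCount (p ^ (k - (i + 1))) (p ^ (i + 1)) Φ (σ ^ p ^ (i + 1)) σ c)
          then p ^ (i + 1) - p ^ i else 0 := by
  -- abbreviate the level conditions
  set L : ℕ → Prop := fun i =>
    ∀ c : ZMod (p ^ (i + 1)),
      rowCount (p ^ (k - (i + 1))) (p ^ (i + 1)) Φ (σ ^ p ^ (i + 1)) σ (c + (p ^ i : ℕ)) =
        rowCount (p ^ (k - (i + 1))) (p ^ (i + 1)) Φ (σ ^ p ^ (i + 1)) σ c with hL
  set ev : AddChar (Additive G) ℂ → ℂ := fun χ => χ (Additive.ofMul σ) with hev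
  set W : Fin k → Set ℂ := fun i => {ω | ω ^ p ^ (i.val + 1) = 1 ∧ ω ^ p ^ i.val ≠ 1 ∧ L i.val} with hW
  -- the vanishing odd characters are the odd characters with `χ(σ) ∈ ⋃ W i`
  have hV : {χ : AddChar (Additive G) ℂ | χ (Additive.ofMul ρ) = -1 ∧ ∑ s ∈ Φ, χ (Additive.ofMul s) = 0} =
      {χ : AddChar (Additive G) ℂ | χ (Additive.ofMul ρ) = -1} ∩ ev ⁻¹' (⋃ i, W i) := by
    ext χ
    simp only [Set.mem_setOf_eq, Set.mem_inter_iff, Set.mem_preimage, Set.mem_iUnion, hev, hW]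
    constructor
    · rintro ⟨hχ, h0⟩
      obtain ⟨i, hi, h1, h2, H⟩ := (sum_char_eq_zero_iff hp2 hσ hρσ hcard h χ hχ).1 h0
      exact ⟨hχ, ⟨i, hi⟩, h1, h2, H⟩
    · rintro ⟨hχ, ⟨i, hi⟩, h1, h2, H⟩
      exact ⟨hχ, (sum_char_eq_zero_iff hp2 hσ hρσ hcard h χ hχ).2 ⟨i, hi, h1, h2, H⟩⟩
  have hinj : Set.InjOn ev ({χ : AddChar (Additive G) ℂ | χ (Additive.ofMul ρ) = -1} ∩ ev ⁻¹' (⋃ i, W i)) :=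
    (oddChar_injOn hσ hρσ hcard).mono Set.inter_subset_left
  rw [hV, ← hinj.ncard_image, Set.image_inter_preimage, hev,
    image_oddChar_eq hσ hρσ hcard (rho_ne_one h) (rho_mul_rho h)]
  -- `μ_{p^k} ∩ ⋃ W i = ⋃ W i`, a disjoint union
  have hWsub : ∀ i, W i ⊆ {ω : ℂ | ω ^ (p ^ k) = 1} := by
    rintro ⟨i, hi⟩ ω ⟨hω, -, -⟩
    simp only [Set.mem_setOf_eq]
    rw [← Nat.sub_add_cancel hi, pow_add, mul_comm, pow_mul, hω, one_pow]
  have hinter : {ω : ℂ | ω ^ (p ^ k) = 1} ∩ (⋃ i, W i) = ⋃ i, W i :=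
    Set.inter_eq_right.2 (Set.iUnion_subset hWsub)
  have hfin : {ω : ℂ | ω ^ (p ^ k) = 1}.Finite := by
    rw [setOf_pow_eq_one_eq_coe_nthRootsFinset (pow_pos hp.out.pos k)]
    exact Finset.finite_toSet _
  have hdisj : Pairwise (Function.onFun Disjoint W) := by
    intro i j hij
    rw [Function.onFun, Set.disjoint_left]
    rintro ω ⟨h1, h2, -⟩ ⟨h1', h2', -⟩
    apply hij
    have e := (orderOf_eq_prime_pow h2 h1).symm.trans (orderOf_eq_prime_pow h2' h1')
    exact Fin.ext (Nat.succ_injective (Nat.pow_right_injective hp.out.two_le e))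
  rw [hinter, Set.ncard_iUnion_of_finite (fun i => hfin.subset (hWsub i)) hdisj, finsum_eq_sum_of_fintype]
  -- count each `W i`
  have hWc : ∀ i : Fin k, (W i).ncard = if L i.val then p ^ (i.val + 1) - p ^ i.val else 0 := by
    intro i
    split_ifs with hLi
    · have : W i = {ω : ℂ | ω ^ p ^ (i.val + 1) = 1 ∧ ω ^ p ^ i.val ≠ 1} := by
        ext ω; simp only [hW, Set.mem_setOf_eq, hLi, and_true]
      rw [this, ncard_setOf_order_eq]
    · have : W i = ∅ := by
        ext ω; simp only [hW, Set.mem_setOf_eq, hLi, and_false, Set.mem_empty_iff_false]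
      rw [this, Set.ncard_empty]
  simp_rw [hWc]
  exact Fin.sum_univ_eq_sum_range (fun i => if L i then p ^ (i + 1) - p ^ i else 0) k

end Defect

/-! ## §5 The rank of every CM type of the cyclic group of order `2p^k` -/

section Rank

variable {G : Type*} [CommGroup G] [Fintype G] [DecidableEq G] {p : ℕ} [hp : Fact p.Prime] {k : ℕ} {ρ σ : G}
  {Φ : Finset G}

open Dodson1984 (ncard_oddChar)

open scoped Classical in
/-- **RANK PLUS DEFECT `= p^k + 1`** (Kubota): `rank(S) + Σ_{i<k} φ(p^{i+1})·[S equidistributed at level i+1]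
= p^k + 1` — the rank of EVERY CM type of the cyclic group `⟨ρ⟩ × ℤ_{p^k}` (Dodson's Prop. 4.4 (1) is `p^k = 9`:
`rank + 2[level 1] + 6[level 2] = 10`). [cite: Kubota1965, §4 Lemma 2] [cite: Dodson1987, Prop. 4.4 (1)]
[cite: Hazama2003CyclicCM, Thm. 4.8] -/
theorem typeRank_add_defect_eq (hp2 : p ≠ 2) (hσ : orderOf σ = p ^ k) (hρσ : ρ ∉ Subgroup.zpowers σ)
    (hcard : Fintype.card G = 2 * p ^ k) (h : IsCMTypeWith ρ (Φ : Set G)) :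
    typeRank G (Φ : Set G) +
        ∑ i ∈ Finset.range k,
          (if (∀ c : ZMod (p ^ (i + 1)),
              rowCount (p ^ (k - (i + 1))) (p ^ (i + 1)) Φ (σ ^ p ^ (i + 1)) σ (c + (p ^ i : ℕ)) =
                rowCount (p ^ (k - (i + 1))) (p ^ (i + 1)) Φ (σ ^ p ^ (i + 1)) σ c)
            then p ^ (i + 1) - p ^ i else 0) = p ^ k + 1 := by
  have hdef := h.typeRank_add_ncard_oddCharacters_vanishing
  rw [ncard_oddChar_vanishing_eq hp2 hσ hρσ hcard h, ncard_oddChar (rho_ne_one h) (rho_mul_rho h) hcard]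
    at hdef
  exact hdef

open scoped Classical in
/-- **NONDEGENERACY CRITERION**: `rank(S) = p^k + 1` iff `S` is equidistributed at NO level.
[cite: Kubota1965, §4 Lemma 2] [cite: Dodson1987, Prop. 4.4 (1)] [cite: Hazama2003CyclicCM, Thm. 4.8 (i)] -/
theorem typeRank_eq_iff (hp2 : p ≠ 2) (hσ : orderOf σ = p ^ k) (hρσ : ρ ∉ Subgroup.zpowers σ)
    (hcard : Fintype.card G = 2 * p ^ k) (h : IsCMTypeWith ρ (Φ : Set G)) :
    typeRank G (Φ : Set G) = p ^ k + 1 ↔ ∀ i < k,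
      ¬ ∀ c : ZMod (p ^ (i + 1)),
        rowCount (p ^ (k - (i + 1))) (p ^ (i + 1)) Φ (σ ^ p ^ (i + 1)) σ (c + (p ^ i : ℕ)) =
          rowCount (p ^ (k - (i + 1))) (p ^ (i + 1)) Φ (σ ^ p ^ (i + 1)) σ c := by
  have key := typeRank_add_defect_eq hp2 hσ hρσ hcard h
  have hpos : ∀ i, 0 < p ^ (i + 1) - p ^ i := fun i =>
    Nat.sub_pos_of_lt (Nat.pow_lt_pow_right hp.out.one_lt (by omega))
  constructor
  · intro hrk i hi hL
    rw [hrk] at key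
    have h0 := Nat.add_left_cancel (key.trans (Nat.add_zero _).symm)
    have := (Finset.sum_eq_zero_iff.1 h0) i (Finset.mem_range.2 hi)
    rw [if_pos hL] at this
    exact (hpos i).ne' this
  · intro H
    rw [Finset.sum_eq_zero (fun i hi => if_neg (H i (Finset.mem_range.1 hi))), add_zero] at key
    exact key

end Rank

/-! ## §6 Stabilisers: the subgroup of order `p` is the least non-trivial subgroup of `⟨σ⟩` -/

section Stabilisers

variable {G : Type*} [CommGroup G] [Fintype G] [DecidableEq G] {p : ℕ} [hp : Fact p.Prime] {k : ℕ} {ρ σ : G}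
  {Φ : Finset G}

omit [Fintype G] [DecidableEq G] in
/-- `σ^{p^{k−1}}` has order `p` for `σ` of order `p^k`, `k ≥ 1`. [folklore] -/
private theorem orderOf_pow_pred (hσ : orderOf σ = p ^ k) (hk : 1 ≤ k) : orderOf (σ ^ p ^ (k - 1)) = p := by
  rw [orderOf_pow' σ (pow_ne_zero _ hp.out.ne_zero), hσ,
    Nat.gcd_eq_right (pow_dvd_pow p (Nat.sub_le k 1)), Nat.pow_div (Nat.sub_le k 1) hp.out.pos,
    show k - (k - 1) = 1 by omega, pow_one]

omit [Fintype G] [DecidableEq G] in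
/-- `σ^{p^{k−1}} ≠ 1`. [folklore] -/
private theorem pow_pred_ne_one (hσ : orderOf σ = p ^ k) (hk : 1 ≤ k) : σ ^ p ^ (k - 1) ≠ 1 := by
  intro h1
  have := orderOf_pow_pred hσ hk
  rw [h1, orderOf_one] at this
  exact hp.out.one_lt.ne this

omit [Fintype G] [DecidableEq G] in
/-- **Every `u ≠ 1` in `⟨σ⟩ ≅ ℤ/p^k` has `σ^{p^{k−1}}` among its powers** (the subgroup of order `p` is the least
non-trivial subgroup of a cyclic `p`-group). [folklore] -/
private theorem exists_pow_eq_pow_pred (hσ : orderOf σ = p ^ k) (hk : 1 ≤ k) {c : ℕ} (hu : σ ^ c ≠ 1) :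
    ∃ m : ℕ, (σ ^ c) ^ m = σ ^ p ^ (k - 1) := by
  have hp0 := hp.out.pos
  -- the order of `u = σ^c` is `p^e`, `e ≥ 1`
  obtain ⟨e, -, he⟩ := (Nat.dvd_prime_pow hp.out).1
    (orderOf_dvd_of_pow_eq_one (show (σ ^ c) ^ p ^ k = 1 by
      rw [← pow_mul, mul_comm, pow_mul, ← hσ, pow_orderOf_eq_one, one_pow]))
  have he0 : e ≠ 0 := by
    rintro rfl
    rw [pow_zero, orderOf_eq_one_iff] at he
    exact hu he
  -- `v = u^{p^{e−1}}` has order `p`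
  set v : G := (σ ^ c) ^ p ^ (e - 1) with hv
  have hov : orderOf v = p := by
    rw [hv, orderOf_pow' _ (pow_ne_zero _ hp.out.ne_zero), he,
      Nat.gcd_eq_right (pow_dvd_pow p (Nat.sub_le e 1)), Nat.pow_div (Nat.sub_le e 1) hp0,
      show e - (e - 1) = 1 by omega, pow_one]
  -- `v = σ^d` with `p^k ∣ dp`, so `v = (σ^{p^{k−1}})^{d'}`
  have hvd : v = σ ^ (c * p ^ (e - 1)) := by rw [hv, ← pow_mul]
  have hdvd : p ^ k ∣ c * p ^ (e - 1) * p := by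
    rw [← hσ]
    refine orderOf_dvd_of_pow_eq_one ?_
    rw [pow_mul, ← hvd, ← hov]
    exact pow_orderOf_eq_one v
  have hk' : p ^ k = p ^ (k - 1) * p := by rw [← pow_succ, Nat.sub_add_cancel hk]
  rw [hk'] at hdvd
  obtain ⟨d', hd'⟩ := Nat.dvd_of_mul_dvd_mul_right hp0 hdvd
  have hvw : v = (σ ^ p ^ (k - 1)) ^ d' := by rw [hvd, hd', pow_mul]
  -- `d'` is prime to `p` (else `v = 1`), so a power of `v` is `σ^{p^{k−1}}`
  have hcop : d'.Coprime (orderOf (σ ^ p ^ (k - 1))) := by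
    rw [orderOf_pow_pred hσ hk, Nat.coprime_comm, Nat.Prime.coprime_iff_not_dvd hp.out]
    rintro ⟨d'', rfl⟩
    have : v = 1 := by
      rw [hvw, pow_mul, ← pow_mul σ, ← pow_succ, Nat.sub_add_cancel hk, ← hσ, pow_orderOf_eq_one, one_pow]
    rw [this, orderOf_one] at hov
    exact hp.out.one_lt.ne' hov.symm
  obtain ⟨m, hm⟩ := exists_pow_eq_self_of_coprime hcop
  refine ⟨p ^ (e - 1) * m, ?_⟩
  rw [pow_mul, ← hv, hvw, hm]

omit [DecidableEq G] in
/-- **A non-trivial stabiliser contains `σ^{p^{k−1}}`** (`p` odd, `k ≥ 1`): some `u ≠ 1` stabilises the CM type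
`S` iff `σ^{p^{k−1}}` does — the stabiliser avoids `ρ⟨σ⟩` (a stabilising `ρσᶜ` would give the stabilising
`(ρσᶜ)^{p^k} = ρ`) and every non-trivial subgroup of `⟨σ⟩ ≅ ℤ/p^k` contains `⟨σ^{p^{k−1}}⟩`.  So PRIMITIVE means
`σ^{p^{k−1}}S ≠ S`: `S` is not induced from the subfield of index `p`. [cite: Dodson1987, Prop. 4.1 (proof)]
[cite: Hazama2003CyclicCM, Prop. 2.3] -/
theorem exists_isStableUnder_iff (hp2 : p ≠ 2) (hσ : orderOf σ = p ^ k) (hk : 1 ≤ k)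
    (hρσ : ρ ∉ Subgroup.zpowers σ) (hcard : Fintype.card G = 2 * p ^ k) (h : IsCMTypeWith ρ (Φ : Set G)) :
    (∃ u : G, u ≠ 1 ∧ IsStableUnder Φ u) ↔ IsStableUnder Φ (σ ^ p ^ (k - 1)) := by
  have hσ' : orderOf σ = 1 * p ^ k := by rw [one_mul, hσ]
  have hcard' : Fintype.card G = 2 * (1 * p ^ k) := by rw [one_mul, hcard]
  have hσk : σ ^ p ^ k = 1 := by rw [← hσ]; exact pow_orderOf_eq_one σ
  constructor
  · rintro ⟨u, hu1, hu⟩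
    obtain ⟨⟨x, c⟩, rfl | rfl⟩ := exists_coord hσ' hρσ hcard' u
    · -- `u = σᶜ ≠ 1`: some power of `u` is `σ^{p^{k−1}}`
      simp only at hu1 hu ⊢
      rw [hσk, one_pow, one_mul] at hu1 hu
      obtain ⟨m, hm⟩ := exists_pow_eq_pow_pred hσ hk hu1
      rw [← hm]
      exact hu.pow m
    · -- `u = ρσᶜ`: then `u^{p^k} = ρ` would stabilise `S`, impossible for a CM type
      exfalso
      simp only at hu
      rw [hσk, one_pow, one_mul] at hu
      have hpq := hu.pow (p ^ k)
      obtain ⟨m, hm⟩ : Odd (p ^ k) := (hp.out.odd_of_ne_two hp2).pow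
      have hρpow : ρ ^ (p ^ k) = ρ := by
        rw [hm, pow_succ, pow_mul, sq ρ, rho_mul_rho h, one_pow, one_mul]
      have hgpow : (σ ^ c.val) ^ (p ^ k) = 1 := by
        rw [← pow_mul, mul_comm, pow_mul, hσk, one_pow]
      rw [mul_pow, hρpow, hgpow, mul_one] at hpq
      have h1 := hpq 1
      have h2 := rho_mul_mem_iff h (1 : G)
      rw [mul_one] at h1 h2
      exact iff_not_self (h1.trans h2)
  · intro H
    exact ⟨σ ^ p ^ (k - 1), pow_pred_ne_one hσ hk, H⟩

omit [DecidableEq G] in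
/-- **Primitivity read on `σ^{p^{k−1}}`.** [cite: Dodson1987, Prop. 4.1 (proof)] [cite: Hazama2003CyclicCM, Prop. 2.3] -/
theorem forall_not_isStableUnder_iff (hp2 : p ≠ 2) (hσ : orderOf σ = p ^ k) (hk : 1 ≤ k)
    (hρσ : ρ ∉ Subgroup.zpowers σ) (hcard : Fintype.card G = 2 * p ^ k) (h : IsCMTypeWith ρ (Φ : Set G)) :
    (∀ u : G, u ≠ 1 → ¬ IsStableUnder Φ u) ↔ ¬ IsStableUnder Φ (σ ^ p ^ (k - 1)) := by
  rw [← exists_isStableUnder_iff hp2 hσ hk hρσ hcard h]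
  simp only [not_exists, not_and]

omit [Fintype G] [DecidableEq G] in
/-- `σ^{(c + n).val} = σ^{c.val} σⁿ` for `c ∈ ℤ/p^{i+1}` and `σ` of order `p^{i+1}`. [folklore] -/
private theorem pow_val_add_natCast {i : ℕ} (hσ : orderOf σ = p ^ (i + 1)) (c : ZMod (p ^ (i + 1))) (n : ℕ) :
    σ ^ (c + (n : ZMod (p ^ (i + 1)))).val = σ ^ c.val * σ ^ n := by
  have h1 := pow_mod_orderOf σ (c.val + n % p ^ (i + 1))
  have h2 := pow_mod_orderOf σ n
  rw [hσ] at h1 h2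
  rw [ZMod.val_add, ZMod.val_natCast, h1, pow_add, h2]

/-- **The top level is stability**: for `σ` of order `p^{i+1}` the counts of `S` on the cosets of the trivial
subgroup `⟨σ^{p^{i+1}}⟩` — the indicator of `S` on `⟨σ⟩` — are invariant under `σ^{p^i}` iff `σ^{p^i} S = S`
(Hazama's (4.7): "`E(S)` is stable under `ℤ/pℤ` ⟺ `S` is stable under the subgroup of order `p`").
[cite: Hazama2003CyclicCM, Lemma 4.6.1 ((4.7))] -/
theorem level_top_iff_isStableUnder {i : ℕ} (hσ : orderOf σ = p ^ (i + 1))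
    (hρσ : ρ ∉ Subgroup.zpowers σ) (hcard : Fintype.card G = 2 * p ^ (i + 1)) (h : IsCMTypeWith ρ (Φ : Set G)) :
    (∀ c : ZMod (p ^ (i + 1)),
      rowCount (p ^ (i + 1 - (i + 1))) (p ^ (i + 1)) Φ (σ ^ p ^ (i + 1)) σ (c + (p ^ i : ℕ)) =
        rowCount (p ^ (i + 1 - (i + 1))) (p ^ (i + 1)) Φ (σ ^ p ^ (i + 1)) σ c) ↔
      IsStableUnder Φ (σ ^ p ^ i) := by
  have hσk : σ ^ p ^ (i + 1) = 1 := by rw [← hσ]; exact pow_orderOf_eq_one σ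
  -- the count on a coset of the trivial subgroup is the indicator
  have hcount : ∀ c : ZMod (p ^ (i + 1)),
      rowCount (p ^ (i + 1 - (i + 1))) (p ^ (i + 1)) Φ (σ ^ p ^ (i + 1)) σ c =
        if σ ^ c.val ∈ Φ then 1 else 0 := by
    intro c
    unfold rowCount
    simp only [hσk, one_pow, one_mul]
    split_ifs with hc
    · rw [Finset.filter_true_of_mem fun _ _ => hc, Finset.card_univ, ZMod.card, Nat.sub_self, pow_zero]
    · rw [Finset.filter_false_of_mem fun _ _ => hc, Finset.card_empty]
  have hσ' : orderOf σ = 1 * p ^ (i + 1) := by rw [one_mul, hσ]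
  have hcard' : Fintype.card G = 2 * (1 * p ^ (i + 1)) := by rw [one_mul, hcard]
  simp_rw [hcount]
  constructor
  · intro H g
    obtain ⟨⟨x, c⟩, rfl | rfl⟩ := exists_coord hσ' hρσ hcard' g
    · simp only [hσk, one_pow, one_mul]
      have Hc := H c
      rw [pow_val_add_natCast hσ] at Hc
      rw [mul_comm (σ ^ p ^ i)]
      by_cases hc : σ ^ c.val ∈ Φ
      · rw [if_pos hc] at Hc
        refine ⟨fun _ => ?_, fun _ => hc⟩
        by_contra hn; rw [if_neg hn] at Hc; exact one_ne_zero Hc.symm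
      · rw [if_neg hc] at Hc
        refine ⟨fun hm => absurd hm hc, fun hm => ?_⟩
        rw [if_pos hm] at Hc; exact absurd Hc one_ne_zero
    · simp only [hσk, one_pow, one_mul]
      have Hc := H c
      rw [pow_val_add_natCast hσ] at Hc
      rw [mul_left_comm, rho_mul_mem_iff h, rho_mul_mem_iff h, not_iff_not, mul_comm (σ ^ p ^ i)]
      by_cases hc : σ ^ c.val ∈ Φ
      · rw [if_pos hc] at Hc
        refine ⟨fun _ => ?_, fun _ => hc⟩
        by_contra hn; rw [if_neg hn] at Hc; exact one_ne_zero Hc.symm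
      · rw [if_neg hc] at Hc
        refine ⟨fun hm => absurd hm hc, fun hm => ?_⟩
        rw [if_pos hm] at Hc; exact absurd Hc one_ne_zero
  · intro H c
    have Hc := H (σ ^ c.val)
    rw [pow_val_add_natCast hσ, mul_comm]
    by_cases hc : σ ^ c.val ∈ Φ
    · rw [if_pos hc, if_pos (Hc.1 hc)]
    · rw [if_neg hc, if_neg (fun hm => hc (Hc.2 hm))]

end Stabilisers

/-! ## §7 Primitive and imprimitive types -/

section Primitive

variable {G : Type*} [CommGroup G] [Fintype G] [DecidableEq G] {p : ℕ} [hp : Fact p.Prime] {k : ℕ} {ρ σ : G}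
  {Φ : Finset G}

/-- The telescoping sum `Σ_{i<n} (p^{i+1} − p^i) = p^n − 1`. [folklore] -/
private theorem sum_totient_levels (n : ℕ) : ∑ i ∈ Finset.range n, (p ^ (i + 1) - p ^ i) = p ^ n - 1 := by
  induction n with
  | zero => simp
  | succ n ih =>
    rw [Finset.sum_range_succ, ih]
    have h1 : 1 ≤ p ^ n := Nat.one_le_pow _ _ hp.out.pos
    have h2 : p ^ n ≤ p ^ (n + 1) := Nat.pow_le_pow_right hp.out.pos (Nat.le_succ n)
    omega

open scoped Classical in
/-- **THE RANK OF A PRIMITIVE TYPE** (`k ≥ 1`): `rank(S) + Σ_{i<k−1} φ(p^{i+1})·[level i+1] = p^k + 1` — the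
top level drops out (`σ^{p^{k−1}} S ≠ S`). For `p^k = 9`: `rank ∈ {10, 8}` (Dodson's Prop. 4.4 (1)); for
`p^k = 27`: `rank = 28 − 2[level 1] − 6[level 2] ∈ {28, 26, 22, 20}`. [cite: Dodson1987, Prop. 4.4 (1)]
[cite: Kubota1965, §4 Lemma 2] [cite: Hazama2003CyclicCM, Thm. 4.8] -/
theorem typeRank_add_eq_of_primitive (hp2 : p ≠ 2) {i₀ : ℕ} (hσ : orderOf σ = p ^ (i₀ + 1))
    (hρσ : ρ ∉ Subgroup.zpowers σ) (hcard : Fintype.card G = 2 * p ^ (i₀ + 1)) (h : IsCMTypeWith ρ (Φ : Set G))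
    (hprim : ∀ u : G, u ≠ 1 → ¬ IsStableUnder Φ u) :
    typeRank G (Φ : Set G) +
        ∑ i ∈ Finset.range i₀,
          (if (∀ c : ZMod (p ^ (i + 1)),
              rowCount (p ^ (i₀ + 1 - (i + 1))) (p ^ (i + 1)) Φ (σ ^ p ^ (i + 1)) σ (c + (p ^ i : ℕ)) =
                rowCount (p ^ (i₀ + 1 - (i + 1))) (p ^ (i + 1)) Φ (σ ^ p ^ (i + 1)) σ c)
            then p ^ (i + 1) - p ^ i else 0) = p ^ (i₀ + 1) + 1 := by
  have key := typeRank_add_defect_eq hp2 hσ hρσ hcard h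
  have hns : ¬ IsStableUnder Φ (σ ^ p ^ i₀) := by
    have := (forall_not_isStableUnder_iff hp2 hσ (Nat.le_add_left 1 i₀) hρσ hcard h).1 hprim
    rwa [Nat.add_sub_cancel] at this
  rw [← level_top_iff_isStableUnder hσ hρσ hcard h] at hns
  rw [Finset.sum_range_succ, if_neg hns, add_zero] at key
  exact key

open scoped Classical in
/-- **Lower bound for primitive types: `rank ≥ p^k − p^{k−1} + 2 = φ(p^k) + 2`** (at most the levels `< k`
vanish, `Σ_{i<k−1} φ(p^{i+1}) = p^{k−1} − 1`).  Ribet's method gives `φ(p^k) + 1 ≤` rank of any primitive type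
(tree `CMTypeRankPrimeSquareBound` for `p²`); on the cyclic minimal group the bound is `φ(p^k) + 2` and is attained
exactly when every lower level is equidistributed. [cite: Dodson1987, Thm. 1.12 and Prop. 4.4 (1)] [cite: Kubota1965, §4 Lemma 2] -/
theorem le_typeRank_of_primitive (hp2 : p ≠ 2) {i₀ : ℕ} (hσ : orderOf σ = p ^ (i₀ + 1))
    (hρσ : ρ ∉ Subgroup.zpowers σ) (hcard : Fintype.card G = 2 * p ^ (i₀ + 1)) (h : IsCMTypeWith ρ (Φ : Set G))
    (hprim : ∀ u : G, u ≠ 1 → ¬ IsStableUnder Φ u) :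
    p ^ (i₀ + 1) - p ^ i₀ + 2 ≤ typeRank G (Φ : Set G) := by
  classical
  have key := typeRank_add_eq_of_primitive hp2 hσ hρσ hcard h hprim
  have hle : ∑ i ∈ Finset.range i₀,
      (if (∀ c : ZMod (p ^ (i + 1)),
          rowCount (p ^ (i₀ + 1 - (i + 1))) (p ^ (i + 1)) Φ (σ ^ p ^ (i + 1)) σ (c + (p ^ i : ℕ)) =
            rowCount (p ^ (i₀ + 1 - (i + 1))) (p ^ (i + 1)) Φ (σ ^ p ^ (i + 1)) σ c)
        then p ^ (i + 1) - p ^ i else 0) ≤ p ^ i₀ - 1 := by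
    rw [← sum_totient_levels (p := p) i₀]
    refine Finset.sum_le_sum fun i _ => ?_
    split_ifs
    · exact le_rfl
    · exact Nat.zero_le _
  have h1 : 1 ≤ p ^ i₀ := Nat.one_le_pow _ _ hp.out.pos
  have h2 : p ^ i₀ ≤ p ^ (i₀ + 1) := Nat.pow_le_pow_right hp.out.pos (Nat.le_succ i₀)
  omega

open scoped Classical in
/-- **The imprimitive types have rank `≤ p^{k−1} + 1`** (the `φ(p^k)` characters of the top level all vanish):
induced from the subfield of index `p`. [cite: Dodson1987, Prop. 4.4 (1)] [cite: Kubota1965, §4 Lemma 2] -/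
theorem typeRank_le_of_not_primitive (hp2 : p ≠ 2) {i₀ : ℕ} (hσ : orderOf σ = p ^ (i₀ + 1))
    (hρσ : ρ ∉ Subgroup.zpowers σ) (hcard : Fintype.card G = 2 * p ^ (i₀ + 1)) (h : IsCMTypeWith ρ (Φ : Set G))
    (hst : ∃ u : G, u ≠ 1 ∧ IsStableUnder Φ u) :
    typeRank G (Φ : Set G) ≤ p ^ i₀ + 1 := by
  have key := typeRank_add_defect_eq hp2 hσ hρσ hcard h
  have hs : IsStableUnder Φ (σ ^ p ^ i₀) := by
    have := (exists_isStableUnder_iff hp2 hσ (Nat.le_add_left 1 i₀) hρσ hcard h).1 hst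
    rwa [Nat.add_sub_cancel] at this
  rw [← level_top_iff_isStableUnder hσ hρσ hcard h] at hs
  rw [Finset.sum_range_succ, if_pos hs] at key
  have h2 : p ^ i₀ ≤ p ^ (i₀ + 1) := Nat.pow_le_pow_right hp.out.pos (Nat.le_succ i₀)
  omega

/-- **Primitive types are exactly the types of rank `> p^{k−1} + 1`** (`p` odd: `φ(p^k) + 2 > p^{k−1} + 1`).
[cite: Dodson1987, Prop. 4.4 (1)] -/
theorem primitive_iff_lt_typeRank (hp2 : p ≠ 2) {i₀ : ℕ} (hσ : orderOf σ = p ^ (i₀ + 1))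
    (hρσ : ρ ∉ Subgroup.zpowers σ) (hcard : Fintype.card G = 2 * p ^ (i₀ + 1)) (h : IsCMTypeWith ρ (Φ : Set G)) :
    (∀ u : G, u ≠ 1 → ¬ IsStableUnder Φ u) ↔ p ^ i₀ + 1 < typeRank G (Φ : Set G) := by
  have h3 : 3 ≤ p := by
    have := hp.out.two_le
    omega
  have hbig : p ^ i₀ + 1 < p ^ (i₀ + 1) - p ^ i₀ + 2 := by
    have : 3 * p ^ i₀ ≤ p ^ (i₀ + 1) := by rw [pow_succ']; exact Nat.mul_le_mul_right _ h3
    have h1 : 1 ≤ p ^ i₀ := Nat.one_le_pow _ _ hp.out.pos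
    omega
  constructor
  · intro hprim
    exact lt_of_lt_of_le hbig (le_typeRank_of_primitive hp2 hσ hρσ hcard h hprim)
  · intro hlt u hu1 hu
    have := typeRank_le_of_not_primitive hp2 hσ hρσ hcard h ⟨u, hu1, hu⟩
    omega

end Primitive

/-! ## §8 `p^k = 27`: the cyclic CM fields of degree `54` (`ℚ(ζ₈₁)`, `ℚ(ζ₁₆₃)`) -/

section TwentySeven

variable {G : Type*} [CommGroup G] [Fintype G] [DecidableEq G] {ρ σ : G} {Φ : Finset G}

/-- **`⟨ρ⟩ × ℤ₂₇` (`σ` of order `27`, `|G| = 54`): a PRIMITIVE type has rank `28, 26, 22` or `20`; an imprimitive one rank `≤ 10`.**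
[cite: Dodson1987, Prop. 4.4 (1) and Remark 4.5] [cite: Kubota1965, §4 Lemma 2] -/
theorem typeRank_mem_of_primitive_twentySeven (hσ : orderOf σ = 27) (hρσ : ρ ∉ Subgroup.zpowers σ)
    (hcard : Fintype.card G = 54) (h : IsCMTypeWith ρ (Φ : Set G)) (hprim : ∀ u : G, u ≠ 1 → ¬ IsStableUnder Φ u) :
    typeRank G (Φ : Set G) ∈ ({28, 26, 22, 20} : Finset ℕ) := by
  classical
  have hσ' : orderOf σ = 3 ^ (2 + 1) := by rw [hσ]; norm_num
  have hcard' : Fintype.card G = 2 * 3 ^ (2 + 1) := by rw [hcard]; norm_num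
  have key := typeRank_add_eq_of_primitive (p := 3) (by norm_num) hσ' hρσ hcard' h hprim
  rw [Finset.sum_range_succ, Finset.sum_range_succ, Finset.sum_range_zero, zero_add] at key
  simp only [Finset.mem_insert, Finset.mem_singleton]
  split_ifs at key <;> norm_num at key <;> omega

/-- **`⟨ρ⟩ × ℤ₂₇`: the imprimitive types (`σ⁹S = S`) have rank `10, 8, 4` or `2`.** [cite: Dodson1987, Prop. 4.4 (1)]
[cite: Kubota1965, §4 Lemma 2] -/
theorem typeRank_mem_of_not_primitive_twentySeven (hσ : orderOf σ = 27) (hρσ : ρ ∉ Subgroup.zpowers σ)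
    (hcard : Fintype.card G = 54) (h : IsCMTypeWith ρ (Φ : Set G)) (hst : ∃ u : G, u ≠ 1 ∧ IsStableUnder Φ u) :
    typeRank G (Φ : Set G) ∈ ({10, 8, 4, 2} : Finset ℕ) := by
  classical
  have hσ' : orderOf σ = 3 ^ (2 + 1) := by rw [hσ]; norm_num
  have hcard' : Fintype.card G = 2 * 3 ^ (2 + 1) := by rw [hcard]; norm_num
  have key := typeRank_add_defect_eq (p := 3) (by norm_num) hσ' hρσ hcard' h
  have hs : IsStableUnder Φ (σ ^ 3 ^ 2) := by
    have := (exists_isStableUnder_iff (p := 3) (by norm_num) hσ' (by norm_num) hρσ hcard' h).1 hst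
    exact this
  rw [← level_top_iff_isStableUnder hσ' hρσ hcard' h] at hs
  rw [Finset.sum_range_succ, Finset.sum_range_succ, Finset.sum_range_succ, Finset.sum_range_zero, zero_add,
    if_pos hs] at key
  simp only [Finset.mem_insert, Finset.mem_singleton]
  split_ifs at key <;> norm_num at key <;> omega

/-- **`⟨ρ⟩ × ℤ₂₇`: primitive iff rank `> 10`.** [cite: Dodson1987, Prop. 4.4 (1)] -/
theorem primitive_iff_twentySeven (hσ : orderOf σ = 27) (hρσ : ρ ∉ Subgroup.zpowers σ)
    (hcard : Fintype.card G = 54) (h : IsCMTypeWith ρ (Φ : Set G)) :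
    (∀ u : G, u ≠ 1 → ¬ IsStableUnder Φ u) ↔ 10 < typeRank G (Φ : Set G) := by
  have hσ' : orderOf σ = 3 ^ (2 + 1) := by rw [hσ]; norm_num
  have hcard' : Fintype.card G = 2 * 3 ^ (2 + 1) := by rw [hcard]; norm_num
  have := primitive_iff_lt_typeRank (p := 3) (by norm_num) hσ' hρσ hcard' h
  norm_num at this
  exact this

end TwentySeven

end PrimePow

end CyclicCMType

end Literature.NumberTheory.ComplexMultiplication
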